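import Summits.QuantumFields.BalabanUV.T4Continuum.Support.NE3ResidualSliceRep
import Summits.QuantumFields.BalabanUV.T4Continuum.Support.NE3EnergyAssembly

/-!
# NE7EtaMinimiserGaugeCovariance — route #1 of the NE7 crux, stub S7 (NODE O, the BACKGROUND COORDINATE): MINIMISERS ARE GAUGE-COVARIANT
# WITH THE DATUM MOVED BY THE CORNER VALUES OF THE GAUGE — the carrier's selection `u·U_A` is a minimiser of run A for the datum
# `ū·V`, `ū = u ∘ (L^{j+1}•)`, and for `V` itself exactly when the selection is read through corner-trivial `u` (located (F3) in kernel)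

Cell `pub-balaban`, rung (B)+1 sub-cell t4, lineage `b2b-balaban-t4-ne7-p1`, generation 24 (CRUX PROVER NE7 #1, ruling e34b3e0c); crux
skeleton `t4/skeletons/NE7-CRUX-R1.md` v1.7.1 §0bis item 10 (ii); companion of `NE7EtaPlainGradientLetters` (p256062, located (F1)–(F3)).
HONEST FRAMING (page 1): FIXED FINITE T⁴, rung (B)+1; NE7, NE3 NOT PRINTED in [Balaban1984PropagatorsI]–[Balaban1989LargeFieldII] and NOT PROVED
here; continuum YM on T⁴ ⇐ BetaPertH ∧ nine spine estimates (0/9 proved); BetaPertH ⇐ (D1) ∧ (D4) ∧ CAP+tail; G-an2-4 gates asym, D1 and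
NE2/3/4; NOT infinite volume, NOT mass gap, NOT Clay.

WHY.  Route 1's tower composition (`T4TowerRateDischarge.uRateUpTo_of_nodes` ∕ `T4TowerRateComposition.uRateUpTo_tower`) reads run A's background
through a SELECTION `uA : ℕ → V → C.BgA` and the closeness binder `C.gauge (uA K v) (C.transport (uB K v)) ≤ δc K`.  NE3's root (T-E_w,
amendment 4) delivers the pair as `gaugeAct u UA = W·e^Z` — closeness of the RE-GAUGED run-A minimiser `u·U_A` to `W = rescale L (bavg L U_B)`.
So the carrier must select `u·U_A`, and the question (F3) is: a minimiser of WHAT?  Bałaban's averages are gauge-COVARIANT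
([Balaban1985Averaging] (45) p. 24; tree `BlockAverageCurrent.rescale_bavg_gaugeAct`, `NE3CpushGaugeCovariance.cavgIter_gaugeAct`): the `(j+1)`-fold
average of `U^u` is `(avg U)^{ū}` with `ū w = u (L^{j+1}·w)` the CORNER VALUES of `u`.  This file proves the consequence for the variational
problem in the everywhere-small-field class `MinimalActionRate.sfClass`:
 * `levelAction_gaugeAct` — the level action is gauge invariant (B11 (5); from `NE3EnergyAssembly.fineAction_gaugeAct`);
 * `mem_admissible_gaugeAct_datum` — `U ∈ admissible (sfClass) L (j+1) V`, `u` unitary and `N·L^{j+1}`-periodic ⟹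
   `U^u ∈ admissible (sfClass) L (j+1) (V^{ū})` (class invariance `NE3ResidualSliceRep.mem_sfClass_gaugeAct` + covariance of the average);
 * **`isMinimiser_gaugeAct`** — `IsMinimiser … (j+1) V U_A` ⟹ `IsMinimiser … (j+1) (V^{ū}) (U_A^u)`: the admissible sets of the two data are
   exchanged by `u` and `u⁻¹`, the action is invariant;
 * `isMinimiser_gaugeAct_of_cornerTrivial` — if `u = 1` on `L^{j+1}ℤ^d` the datum is KEPT (`V^{ū} = V`; NE3's residual-slice representatives
   `NE3ResidualSliceRep.ResidualSliceRep.cornerTrivial` are of this kind, cf. `mem_admissible_gaugeAct` there).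
CONSEQUENCE FOR NODE O (recorded, not typed; 0 def): reading the selection `u·U_A` as «run A's background for the datum v» needs EITHER a
gauge-invariance binder on run A's functionals (printed TYPE, [Balaban1987RG1] §1) OR a corner-trivial `u` in the root; the root's typing
(amendment 4) displays neither, NE3's chart road over-delivers the second.  HONEST.  [folklore] bookkeeping over landed modules; nothing of
NE3∕NE7 discharged; no carrier instantiated; 0 def; 0 sorry; nothing printed is a hypothesis of a theorem.
-/

set_option autoImplicit false

open scoped BigOperators Matrix Matrix.Norms.L2Operator
open Finset NormedSpace

namespace Summit.QuantumFields.BalabanUV.T4Continuum.NE7EtaMinimiserGaugeCovariance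

open Literature.MathematicalPhysics.QuantumFieldTheory.Balaban1983to89
open B7Prop1Explicit B7Prop2Explicit
open T4AveragingDeficitWall hiding Site Plane Plaq Bond
open T4AveragingDeficitWallBoundary (IsPeriodicCfg periodBox)
open AveragingDeficitMultiLevelPrep (cavgIter LevelSmall)
open AveragingDeficitMultiLevelBridge (cavgIter_eq_avgIter)
open AveragingDeficitKDatum (gaugeAct_inv_gaugeAct)
open MinimalActionLevels (levelAction)
open MinimalActionSandwich (IsMinimiser admissible)
open MinimalActionRate (sfClass)
open NE3EnergyShapes (IsUnitarySite IsPeriodicSite)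
open NE3EnergyAssembly (fineAction_gaugeAct)
open NE3ResidualSliceRep (mem_sfClass_gaugeAct)
open NE3CpushGaugeCovariance (cavgIter_gaugeAct)

noncomputable section

variable {d : ℕ} {n : Type*} [Fintype n] [DecidableEq n]

/-! ## §1 Invariance of the level action; the inverse gauge -/

/-- **THE LEVEL-`k` ACTION IS GAUGE INVARIANT**: `A^{(k)}(U^u) = A^{(k)}(U)` for every site field `u` (closed plaquette contours; B11 (5) with
B7 (8)). [folklore] -/
theorem levelAction_gaugeAct (L N k : ℕ) (u : Site d → (Matrix n n ℂ)ˣ) (U : Site d → Fin d → (Matrix n n ℂ)ˣ) :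
    levelAction d L N k (gaugeAct u U) = levelAction d L N k U := by
  unfold levelAction
  rw [fineAction_gaugeAct]

/-- The pointwise inverse of a unitary site field is unitary. [folklore] -/
theorem isUnitarySite_inv {u : Site d → (Matrix n n ℂ)ˣ} (hu : IsUnitarySite u) : IsUnitarySite fun z => (u z)⁻¹ :=
  fun z => (unitaryUnits (Matrix n n ℂ)).inv_mem (hu z)

/-- The pointwise inverse of a `P`-periodic site field is `P`-periodic. [folklore] -/
theorem isPeriodicSite_inv {u : Site d → (Matrix n n ℂ)ˣ} {P : ℤ} (hu : IsPeriodicSite u P) :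
    IsPeriodicSite (fun z => (u z)⁻¹) P :=
  fun x i => by simp only [hu x i]

/-- The corner values of a unitary site field are unitary. [folklore] -/
theorem isUnitarySite_corner {u : Site d → (Matrix n n ℂ)ˣ} (hu : IsUnitarySite u) (M : ℤ) :
    IsUnitarySite fun w : Site d => u (M • w) :=
  fun w => hu (M • w)

/-! ## §2 Covariance of admissibility and of minimisers, with the datum moved by the corner values -/

/-- **THE `(j+1)`-FOLD AVERAGE IS GAUGE-COVARIANT ON THE SMALL-FIELD CLASS**: for `U ∈ sfClass d L N ε (j+1)` under the class smallness
`LevelSmall d L j (ε∕(L^{j+1})²)` and unitary `u`, `avgIter L (U^u) (j+1) = (avgIter L U (j+1))^{ū}`, `ū w = u (L^{j+1}·w)`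
(`NE3CpushGaugeCovariance.cavgIter_gaugeAct` read through `cavgIter_eq_avgIter`). [cite: Balaban1985Averaging, (45) p.24] -/
theorem avgIter_gaugeAct_sfClass [Nonempty n] {L N : ℕ} (hL : 1 ≤ L) {ε : ℝ} (hε : 0 ≤ ε) (j : ℕ)
    (hs : LevelSmall d L j (ε / ((L : ℝ) ^ (j + 1)) ^ 2)) {U : Site d → Fin d → (Matrix n n ℂ)ˣ}
    (hU : U ∈ sfClass d L N ε (j + 1)) {u : Site d → (Matrix n n ℂ)ˣ} (hu : IsUnitarySite u) :
    avgIter L (gaugeAct u U) (j + 1) = gaugeAct (fun w : Site d => u (((L : ℤ) ^ (j + 1)) • w)) (avgIter L U (j + 1)) := by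
  have hx : 0 ≤ ε / ((L : ℝ) ^ (j + 1)) ^ 2 := by positivity
  rw [← cavgIter_eq_avgIter, ← cavgIter_eq_avgIter]
  exact cavgIter_gaugeAct hL j hU.1 hx hs hU.2.2 hu

/-- **ADMISSIBILITY IS GAUGE-COVARIANT WITH THE DATUM MOVED**: `U ∈ admissible (sfClass d L N ε) L (j+1) V`, `u` unitary and
`N·L^{j+1}`-periodic ⟹ `U^u ∈ admissible (sfClass d L N ε) L (j+1) (V^{ū})`, `ū w = u (L^{j+1}·w)`. [folklore] -/
theorem mem_admissible_gaugeAct_datum [Nonempty n] {L N : ℕ} (hL : 1 ≤ L) {ε : ℝ} (hε : 0 ≤ ε) (j : ℕ)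
    (hs : LevelSmall d L j (ε / ((L : ℝ) ^ (j + 1)) ^ 2)) {V U : Site d → Fin d → (Matrix n n ℂ)ˣ}
    (hU : U ∈ admissible (sfClass d L N ε) L (j + 1) V) {u : Site d → (Matrix n n ℂ)ˣ} (hu : IsUnitarySite u)
    (huP : IsPeriodicSite u ((N * L ^ (j + 1) : ℕ) : ℤ)) :
    gaugeAct u U ∈ admissible (sfClass d L N ε) L (j + 1) (gaugeAct (fun w : Site d => u (((L : ℤ) ^ (j + 1)) • w)) V) := by
  obtain ⟨hcl, havg⟩ := hU
  refine ⟨mem_sfClass_gaugeAct hu huP hcl, ?_⟩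
  rw [avgIter_gaugeAct_sfClass hL hε j hs hcl hu, havg]

/-- **MINIMISERS ARE GAUGE-COVARIANT WITH THE DATUM MOVED BY THE CORNER VALUES** ((F3) in kernel): if `U_A` minimises the level-`(j+1)`
action over `admissible (sfClass d L N ε) L (j+1) V` then, for every unitary `N·L^{j+1}`-periodic site field `u`, `U_A^u` minimises it over
`admissible (sfClass d L N ε) L (j+1) (V^{ū})`, `ū w = u (L^{j+1}·w)` — the two admissible sets are exchanged by `u` and `u⁻¹`
(`mem_admissible_gaugeAct_datum` both ways, `gaugeAct_inv_gaugeAct`) and the action is invariant (`levelAction_gaugeAct`).  So the selection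
`u·U_A` forced on NODE O's carrier by the root's representation `gaugeAct u UA = W·e^Z` is a minimiser of run A for the datum `ū·V`, which is
`V` only for corner-trivial `u`. [folklore] -/
theorem isMinimiser_gaugeAct [Nonempty n] {L N : ℕ} (hL : 1 ≤ L) {ε : ℝ} (hε : 0 ≤ ε) (j : ℕ)
    (hs : LevelSmall d L j (ε / ((L : ℝ) ^ (j + 1)) ^ 2)) {V UA : Site d → Fin d → (Matrix n n ℂ)ˣ}
    (hA : IsMinimiser d (sfClass d L N ε) L N (j + 1) V UA) {u : Site d → (Matrix n n ℂ)ˣ} (hu : IsUnitarySite u)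
    (huP : IsPeriodicSite u ((N * L ^ (j + 1) : ℕ) : ℤ)) :
    IsMinimiser d (sfClass d L N ε) L N (j + 1) (gaugeAct (fun w : Site d => u (((L : ℤ) ^ (j + 1)) • w)) V) (gaugeAct u UA) := by
  refine ⟨mem_admissible_gaugeAct_datum hL hε j hs hA.mem hu huP, fun U' hU' => ?_⟩
  -- pull the competitor back to the datum `V` with the inverse gauge
  have hui : IsUnitarySite fun z => (u z)⁻¹ := isUnitarySite_inv hu
  have huiP : IsPeriodicSite (fun z => (u z)⁻¹) ((N * L ^ (j + 1) : ℕ) : ℤ) := isPeriodicSite_inv huP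
  have hback := mem_admissible_gaugeAct_datum hL hε j hs hU' hui huiP
  -- the corner values of `u⁻¹` undo those of `u` on the datum
  have hdatum : gaugeAct (fun w : Site d => (u (((L : ℤ) ^ (j + 1)) • w))⁻¹)
      (gaugeAct (fun w : Site d => u (((L : ℤ) ^ (j + 1)) • w)) V) = V :=
    gaugeAct_inv_gaugeAct (fun w : Site d => u (((L : ℤ) ^ (j + 1)) • w)) V
  have hback' : gaugeAct (fun z => (u z)⁻¹) U' ∈ admissible (sfClass d L N ε) L (j + 1) V := by
    have e : (fun w : Site d => (fun z => (u z)⁻¹) (((L : ℤ) ^ (j + 1)) • w))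
        = fun w : Site d => (u (((L : ℤ) ^ (j + 1)) • w))⁻¹ := rfl
    rw [e, hdatum] at hback
    exact hback
  have hle := hA.le _ hback'
  rw [levelAction_gaugeAct] at hle
  rw [levelAction_gaugeAct]
  exact hle

/-- **CORNER-TRIVIAL GAUGES KEEP THE DATUM**: if moreover `u (L^{j+1}·w) = 1` for all `w` (the kind of NE3's residual-slice representatives,
`NE3ResidualSliceRep.ResidualSliceRep.cornerTrivial`), then `U_A^u` is again a minimiser for the SAME datum `V`. [folklore] -/
theorem isMinimiser_gaugeAct_of_cornerTrivial [Nonempty n] {L N : ℕ} (hL : 1 ≤ L) {ε : ℝ} (hε : 0 ≤ ε) (j : ℕ)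
    (hs : LevelSmall d L j (ε / ((L : ℝ) ^ (j + 1)) ^ 2)) {V UA : Site d → Fin d → (Matrix n n ℂ)ˣ}
    (hA : IsMinimiser d (sfClass d L N ε) L N (j + 1) V UA) {u : Site d → (Matrix n n ℂ)ˣ} (hu : IsUnitarySite u)
    (huP : IsPeriodicSite u ((N * L ^ (j + 1) : ℕ) : ℤ)) (hc : ∀ w : Site d, u (((L : ℤ) ^ (j + 1)) • w) = 1) :
    IsMinimiser d (sfClass d L N ε) L N (j + 1) V (gaugeAct u UA) := by
  have h := isMinimiser_gaugeAct hL hε j hs hA hu huP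
  have h1 : (fun w : Site d => u (((L : ℤ) ^ (j + 1)) • w)) = fun _ => (1 : (Matrix n n ℂ)ˣ) := funext fun w => hc w
  have h2 : gaugeAct (fun _ : Site d => (1 : (Matrix n n ℂ)ˣ)) V = V := by
    funext x μ
    simp only [gaugeAct, one_mul, inv_one, mul_one]
  rw [h1, h2] at h
  exact h

/-- **THE DATUM MOVES EXACTLY BY THE CORNER VALUES — AND ONLY A CORNER-TRIVIAL (up to the stabiliser) `u` KEEPS IT**: for the representation
`gaugeAct u UA = W·e^Z` of NE3's root with `U_A` admissible for `V`, the `(j+1)`-fold average of the represented configuration is `V^{ū}`: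
`avgIter L (W·e^Z) (j+1) = ū·V`.  (So `avgIter L (W·e^Z) (j+1) = V`, the fibre equation NE3's chart road works with, holds iff `ū` stabilises
`V`.) [folklore] -/
theorem avgIter_rep_eq_datum [Nonempty n] {L N : ℕ} (hL : 1 ≤ L) {ε : ℝ} (hε : 0 ≤ ε) (j : ℕ)
    (hs : LevelSmall d L j (ε / ((L : ℝ) ^ (j + 1)) ^ 2)) {V UA W : Site d → Fin d → (Matrix n n ℂ)ˣ}
    (hA : UA ∈ admissible (sfClass d L N ε) L (j + 1) V) {u : Site d → (Matrix n n ℂ)ˣ} (hu : IsUnitarySite u)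
    {Z : Site d → Fin d → Matrix n n ℂ} (hrep : gaugeAct u UA = vary W Z 1) :
    avgIter L (vary W Z 1) (j + 1) = gaugeAct (fun w : Site d => u (((L : ℤ) ^ (j + 1)) • w)) V := by
  rw [← hrep, avgIter_gaugeAct_sfClass hL hε j hs hA.1 hu, hA.2]

end

end Summit.QuantumFields.BalabanUV.T4Continuum.NE7EtaMinimiserGaugeCovariance
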